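import Literature.NumberTheory.GaloisRepresentations.SUnitsIdeleBridge
import Literature.NumberTheory.GaloisRepresentations.RestrictedRamificationOpenSubgroupLayers
import HarnessLib

/-!
# The inflation `Hⁿ(Gal(E/F₀), 𝒪_{E,S}ˣ) → Hⁿ(Gal(E′/F₀), 𝒪_{E′,S}ˣ)` for intermediate fields
# `F₀ ≤ E ≤ E′` of `K̄/K` (NSW VIII §3: the transition maps of `E_S = lim→ 𝒪_{E,S}^×`)

Topic `NumberTheory/GaloisRepresentations`; namespace
`Literature.NumberTheory.GaloisRepresentations.SUnits.Layers`.  Definitions with bodies (plumbing: the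
pair morphism and the induced map on `groupCohomology`, with ALL the inclusion algebras / scalar towers /
normality instances of a chain `F₀ ≤ E ≤ E′ ⊆ K̄` supplied internally, so that consumers quantify over
`IntermediateField`s only) and theorems; NO named fact, no `sorry`, no instance, no notation.

For `F₀ ≤ E ≤ E′` intermediate fields of `K̄/K` with `E/K` normal, all algebras being the inclusions
(`OpenSubgroupLayer.algOfLE`, ruling (α) of lane «PT3-TC»):
* `layerInflHom S hF hEE′ : Rep.res (restrictNormalHom E) (sUnitsRep K S F₀ E) ⟶ sUnitsRep K S F₀ E′` —
  (β2-b)'s `IdeleCohomology.sUnitsRepInflHom` (the inclusion `𝒪_{E,S}ˣ ⊆ 𝒪_{E′,S}ˣ` over `τ ↦ τ|_E`) in this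
  instance context; `coe_layerInflHom` (it is `x ↦ x` on `K̄`-values);
* **`layerInf S hF hEE′ n : Hⁿ(Gal(E/F₀), 𝒪_{E,S}ˣ) ⟶ Hⁿ(Gal(E′/F₀), 𝒪_{E′,S}ˣ)`** (`= IdeleCohomology.sUnitsRepInf`,
  `layerInf_eq_sUnitsRepInf`), and its **transitivity** `layerInf_comp : layerInf E E₁ ≫ layerInf E₁ E₂ = layerInf E E₂`
  (Mathlib `groupCohomology.map_comp` + `map_congr'`).

These are the maps against which the LAYER SUPPLY statements (iii-fin)/(iv-fin) of NSW (8.3.11) are phrased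
(`∃ E′ ≥ E, ∃ z, p • z = layerInf … 2 c`, `p • c = 0 → ∃ E′ ≥ E, layerInf … 3 c = 0`) and which (A2-β2) identifies
with the transitions `stepG` of door-c4's layer system for `E_S` restricted to an open `U ≤ G_{K,S}`.
Lane «PT3-TC» of cell `bsd-eis` (crux `GoodLatticeBDPValue`, stmt-BirchSwinnertonDyer-19032; road memo `PT3TC-ROAD.md`).

## References
* J. Neukirch, A. Schmidt, K. Wingberg, *Cohomology of Number Fields*, 2nd ed. (2008), VIII §3 (`E_S = lim→ 𝒪_{K,S}^×`),
  (8.3.11). [NeukirchSchmidtWingberg2008]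
* D. Harari, *Galois Cohomology and Class Field Theory* (2020), §17.4 (17.1). [Harari2020]
-/

noncomputable section

open NumberField IsDedekindDomain CategoryTheory
open Literature.NumberTheory.GaloisRepresentations.OpenSubgroupLayer (algOfLE isScalarTower_algOfLE)

namespace Literature.NumberTheory.GaloisRepresentations

namespace SUnits

namespace Layers

variable {K : Type} [Field K] [NumberField K] (S : Set (HeightOneSpectrum (𝓞 K)))

/-! ### §1. Instances along a chain `F₀ ≤ E ≤ E′ ⊆ K̄` (theorems, used through `haveI`) -/

omit [NumberField K] in
/-- `F₀ → E → E′` is a scalar tower for the inclusion algebras. [cite: NeukirchSchmidtWingberg2008, VIII §3] -/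
theorem isScalarTower_algOfLE₃ {F₀ E E' : IntermediateField K (AlgebraicClosure K)} (hF : F₀ ≤ E) (hEE' : E ≤ E') :
    letI := algOfLE hF
    letI := algOfLE hEE'
    letI := algOfLE (hF.trans hEE')
    IsScalarTower F₀ E E' :=
  letI := algOfLE hF
  letI := algOfLE hEE'
  letI := algOfLE (hF.trans hEE')
  IsScalarTower.of_algebraMap_eq fun _ => rfl

omit [NumberField K] in
/-- `E/F₀` is normal when `E/K` is (`K ≤ F₀ ≤ E`). [cite: NeukirchSchmidtWingberg2008, VIII §3] -/
theorem normal_algOfLE {F₀ E : IntermediateField K (AlgebraicClosure K)} (hF : F₀ ≤ E) [Normal K E] :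
    letI := algOfLE hF
    Normal F₀ E :=
  letI := algOfLE hF
  haveI := isScalarTower_algOfLE (K := K) hF
  Normal.tower_top_of_normal K F₀ E

omit [NumberField K] in
/-- `(τ|_E)(x) = τ(x)` in `K̄` for `τ ∈ Gal(E′/F₀)` and `x ∈ E ≤ E′` (Mathlib `AlgEquiv.restrictNormal_commutes`).
[cite: NeukirchSchmidtWingberg2008, VIII §3] -/
theorem coe_restrictNormal_apply {F₀ E E' : IntermediateField K (AlgebraicClosure K)} (hF : F₀ ≤ E) (hEE' : E ≤ E')
    [Normal K E] (τ : letI := algOfLE (hF.trans hEE'); E' ≃ₐ[F₀] E') (x : E) :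
    letI := algOfLE hF
    letI := algOfLE hEE'
    letI := algOfLE (hF.trans hEE')
    haveI := normal_algOfLE hF
    haveI := isScalarTower_algOfLE₃ hF hEE'
    ((τ.restrictNormal E x : E) : AlgebraicClosure K) = ((τ ⟨(x : AlgebraicClosure K), hEE' x.2⟩ : E') : AlgebraicClosure K) := by
  letI := algOfLE hF
  letI := algOfLE hEE'
  letI := algOfLE (hF.trans hEE')
  haveI := normal_algOfLE (K := K) hF
  haveI := isScalarTower_algOfLE₃ hF hEE'
  have h := AlgEquiv.restrictNormal_commutes τ E x
  exact congrArg (fun y : E' => (y : AlgebraicClosure K)) h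

/-! ### §2. The pair morphism and the inflation on `Hⁿ` -/

/-- **`𝒪_{E,S}ˣ ⊆ 𝒪_{E′,S}ˣ` over `τ ↦ τ|_E`** as a morphism `Res (sUnitsRep K S F₀ E) ⟶ sUnitsRep K S F₀ E′`
((β2-b) `IdeleCohomology.sUnitsRepInflHom` with the inclusion instances of `F₀ ≤ E ≤ E′ ⊆ K̄`).
[cite: NeukirchSchmidtWingberg2008, VIII §3 (`E_S = lim→ 𝒪_{K,S}^×`)] [cite: Harari2020, §17.4 (17.1)] -/
def layerInflHom {F₀ E E' : IntermediateField K (AlgebraicClosure K)} (hF : F₀ ≤ E) (hEE' : E ≤ E') [Normal K E] :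
    letI := algOfLE hF
    letI := algOfLE hEE'
    letI := algOfLE (hF.trans hEE')
    haveI := normal_algOfLE (K := K) hF
    haveI := isScalarTower_algOfLE₃ hF hEE'
    Rep.res (AlgEquiv.restrictNormalHom E) (sUnitsRep K S F₀ E) ⟶ sUnitsRep K S F₀ E' :=
  letI := algOfLE hF
  letI := algOfLE hEE'
  letI := algOfLE (hF.trans hEE')
  haveI := normal_algOfLE (K := K) hF
  haveI := isScalarTower_algOfLE₃ hF hEE'
  haveI := isScalarTower_algOfLE (K := K) hF
  haveI := isScalarTower_algOfLE (K := K) hEE'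
  haveI := isScalarTower_algOfLE (K := K) (hF.trans hEE')
  IdeleCohomology.sUnitsRepInflHom (K := K) (F := F₀) (E := E) (E' := E') S

/-- **`layerInflHom` is `x ↦ x` on `K̄`-values.** [cite: NeukirchSchmidtWingberg2008, VIII §3] -/
theorem coe_layerInflHom {F₀ E E' : IntermediateField K (AlgebraicClosure K)} (hF : F₀ ≤ E) (hEE' : E ≤ E')
    [Normal K E] (x : letI := algOfLE hF; (sUnitsRep K S F₀ E).V) :
    (((((Additive.toMul ((layerInflHom S hF hEE').hom x)) : sUnits K S E') : (E')ˣ) : E') : AlgebraicClosure K) =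
      ((((Additive.toMul x : sUnits K S E) : Eˣ) : E) : AlgebraicClosure K) := rfl

/-- **`Inf : Hⁿ(Gal(E/F₀), 𝒪_{E,S}ˣ) ⟶ Hⁿ(Gal(E′/F₀), 𝒪_{E′,S}ˣ)`** for `F₀ ≤ E ≤ E′ ⊆ K̄`, `E/K` normal
(Mathlib `groupCohomology.map (restrictNormalHom E) (layerInflHom …) n`).
[cite: NeukirchSchmidtWingberg2008, VIII §3 (8.3.11)] [cite: Harari2020, §17.4 (17.1)] -/
def layerInf {F₀ E E' : IntermediateField K (AlgebraicClosure K)} (hF : F₀ ≤ E) (hEE' : E ≤ E') [Normal K E]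
    (n : ℕ) :
    letI := algOfLE hF
    letI := algOfLE (hF.trans hEE')
    groupCohomology (sUnitsRep K S F₀ E) n ⟶ groupCohomology (sUnitsRep K S F₀ E') n :=
  letI := algOfLE hF
  letI := algOfLE hEE'
  letI := algOfLE (hF.trans hEE')
  haveI := normal_algOfLE (K := K) hF
  haveI := isScalarTower_algOfLE₃ hF hEE'
  groupCohomology.map (AlgEquiv.restrictNormalHom E) (layerInflHom S hF hEE') n

/-- `layerInf` is (β2-b)'s `IdeleCohomology.sUnitsRepInf` in the inclusion instance context (unfolding).
[cite: NeukirchSchmidtWingberg2008, VIII §3 (8.3.11)] -/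
theorem layerInf_eq_sUnitsRepInf {F₀ E E' : IntermediateField K (AlgebraicClosure K)} (hF : F₀ ≤ E) (hEE' : E ≤ E')
    [Normal K E] (n : ℕ) :
    layerInf S hF hEE' n =
      (letI := algOfLE hF
       letI := algOfLE hEE'
       letI := algOfLE (hF.trans hEE')
       haveI := normal_algOfLE (K := K) hF
       haveI := isScalarTower_algOfLE₃ hF hEE'
       haveI := isScalarTower_algOfLE (K := K) hF
       haveI := isScalarTower_algOfLE (K := K) hEE'
       haveI := isScalarTower_algOfLE (K := K) (hF.trans hEE')
       IdeleCohomology.sUnitsRepInf (K := K) (F := F₀) (E := E) (E' := E') S n) :=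
  rfl

/-- `layerInf` as `groupCohomology.map` (unfolding). [cite: NeukirchSchmidtWingberg2008, VIII §3 (8.3.11)] -/
theorem layerInf_eq_map {F₀ E E' : IntermediateField K (AlgebraicClosure K)} (hF : F₀ ≤ E) (hEE' : E ≤ E')
    [Normal K E] (n : ℕ) :
    layerInf S hF hEE' n =
      (letI := algOfLE hF
       letI := algOfLE hEE'
       letI := algOfLE (hF.trans hEE')
       haveI := normal_algOfLE (K := K) hF
       haveI := isScalarTower_algOfLE₃ hF hEE'
       groupCohomology.map (AlgEquiv.restrictNormalHom E) (layerInflHom S hF hEE') n) :=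
  rfl

omit [NumberField K] in
/-- `(τ|_{E₁})|_E = τ|_E` for `F₀ ≤ E ≤ E₁ ≤ E₂` (as monoid homomorphisms `Gal(E₂/F₀) → Gal(E/F₀)`).
[cite: NeukirchSchmidtWingberg2008, VIII §3] -/
theorem restrictNormalHom_comp_restrictNormalHom {F₀ E E₁ E₂ : IntermediateField K (AlgebraicClosure K)}
    (hF : F₀ ≤ E) (h₁ : E ≤ E₁) (h₂ : E₁ ≤ E₂) [Normal K E] [Normal K E₁] :
    letI := algOfLE hF
    letI := algOfLE h₁
    letI := algOfLE h₂
    letI := algOfLE (h₁.trans h₂)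
    letI := algOfLE (hF.trans h₁)
    letI := algOfLE ((hF.trans h₁).trans h₂)
    haveI := normal_algOfLE (K := K) hF
    haveI := normal_algOfLE (K := K) (hF.trans h₁)
    haveI := isScalarTower_algOfLE₃ hF h₁
    haveI := isScalarTower_algOfLE₃ (hF.trans h₁) h₂
    haveI := isScalarTower_algOfLE₃ hF (h₁.trans h₂)
    (AlgEquiv.restrictNormalHom (F := F₀) (K₁ := E₁) E).comp (AlgEquiv.restrictNormalHom (F := F₀) (K₁ := E₂) E₁) =
      AlgEquiv.restrictNormalHom (F := F₀) (K₁ := E₂) E := by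
  letI := algOfLE hF
  letI := algOfLE h₁
  letI := algOfLE h₂
  letI := algOfLE (h₁.trans h₂)
  letI := algOfLE (hF.trans h₁)
  letI := algOfLE ((hF.trans h₁).trans h₂)
  haveI := normal_algOfLE (K := K) hF
  haveI := normal_algOfLE (K := K) (hF.trans h₁)
  haveI := isScalarTower_algOfLE₃ hF h₁
  haveI := isScalarTower_algOfLE₃ (hF.trans h₁) h₂
  haveI := isScalarTower_algOfLE₃ hF (h₁.trans h₂)
  refine MonoidHom.ext fun τ => AlgEquiv.ext fun (x : E) => Subtype.ext ?_
  change (((AlgEquiv.restrictNormal (AlgEquiv.restrictNormal τ E₁) E) x : E) : AlgebraicClosure K) =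
    ((AlgEquiv.restrictNormal τ E x : E) : AlgebraicClosure K)
  rw [coe_restrictNormal_apply hF h₁, coe_restrictNormal_apply (hF.trans h₁) h₂, coe_restrictNormal_apply hF (h₁.trans h₂)]

/-- **Transitivity `Inf_{E₁}^{E₂} ∘ Inf_E^{E₁} = Inf_E^{E₂}`** for `F₀ ≤ E ≤ E₁ ≤ E₂ ⊆ K̄` (Mathlib
`groupCohomology.map_comp`; the pair morphisms compose to the inclusion `𝒪_{E,S}ˣ ⊆ 𝒪_{E₂,S}ˣ`).
[cite: NeukirchSchmidtWingberg2008, VIII §3 (8.3.11)] -/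
theorem layerInf_comp {F₀ E E₁ E₂ : IntermediateField K (AlgebraicClosure K)} (hF : F₀ ≤ E) (h₁ : E ≤ E₁)
    (h₂ : E₁ ≤ E₂) [Normal K E] [Normal K E₁] (n : ℕ) :
    layerInf S hF h₁ n ≫ layerInf S (hF.trans h₁) h₂ n = layerInf S hF (h₁.trans h₂) n := by
  letI := algOfLE hF
  letI := algOfLE h₁
  letI := algOfLE h₂
  letI := algOfLE (h₁.trans h₂)
  letI := algOfLE (hF.trans h₁)
  letI := algOfLE ((hF.trans h₁).trans h₂)
  haveI := normal_algOfLE (K := K) hF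
  haveI := normal_algOfLE (K := K) (hF.trans h₁)
  haveI := isScalarTower_algOfLE₃ hF h₁
  haveI := isScalarTower_algOfLE₃ (hF.trans h₁) h₂
  haveI := isScalarTower_algOfLE₃ hF (h₁.trans h₂)
  rw [layerInf_eq_map, layerInf_eq_map, layerInf_eq_map, ← groupCohomology.map_comp]
  refine Literature.Algebra.Homology.map_congr' (restrictNormalHom_comp_restrictNormalHom hF h₁ h₂) _ _
    (fun x => ?_) n
  apply (Additive.toMul (α := sUnits K S E₂)).injective
  refine Subtype.ext (Units.ext (Subtype.ext ?_))
  rfl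

/-- Transitivity, applied to a class. [cite: NeukirchSchmidtWingberg2008, VIII §3 (8.3.11)] -/
theorem layerInf_layerInf_apply {F₀ E E₁ E₂ : IntermediateField K (AlgebraicClosure K)} (hF : F₀ ≤ E) (h₁ : E ≤ E₁)
    (h₂ : E₁ ≤ E₂) [Normal K E] [Normal K E₁] (n : ℕ)
    (c : letI := algOfLE hF; groupCohomology (sUnitsRep K S F₀ E) n) :
    layerInf S (hF.trans h₁) h₂ n (layerInf S hF h₁ n c) = layerInf S hF (h₁.trans h₂) n c := by
  rw [← layerInf_comp S hF h₁ h₂ n]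
  rfl

end Layers

end SUnits

end Literature.NumberTheory.GaloisRepresentations

end
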